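import Literature.Barriers.CriticalPhenomena.GridSAWStructuredDrawing
import HarnessLib

/-!
# Named grid drawings, II: composing valid drawings (relabel, translate, juxtapose, add edges)

Continuation of `GridSAWStructuredDrawing.lean` (`SDrawing α`: a grid drawing keyed by vertex
names, and `SDrawing.IsValid`, the conditions of `IsGridDrawing` on names). The grid embedding
`E₀` of a gadget graph (Liśkiewicz–Ogihara–Toda 2003, proof of Theorem 7; tree fact
`LOT2003_lemma4_gadgets`, whose approach-independent end `LOT2003_lemma4_gadgets_of_family` in
`GridSAWGadgetsFromDrawnFamily.lean` consumes a valid `SDrawing ℕ`) is assembled from translated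
copies of finitely many verified STAMPS joined by cables. This file proves that validity survives
the four operations such an assembly uses, so that only the stamps (by `decide`, through the
Boolean checker `SDrawing.validB` for drawings on finitely many listed names) and the arithmetic of
the cable routes remain to be checked:

* `SDrawing.relabel f g` (new names, `g ∘ f = id` on the vertices) — `IsValid.relabel`;
* `SDrawing.translate v` — `IsValid.translate`;
* `SDrawing.append S₁ S₂` (juxtaposition of two drawings with disjoint names and disjoint point
  sets `points` = vertex images and path points) — `IsValid.append`;
* `SDrawing.addEdges S E` (new edges between listed vertices: each a well-formed grid path whose
  interior avoids every listed vertex image and every point of the other edges, no repeated end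
  pair, degrees stay `≤ 3`) — `IsValid.addEdges`;
* `SDrawing.validB` with `validB_eq_true_iff : S.validB = true ↔ S.IsValid` (for stamps given by
  explicit lists).

## References

* M. Liśkiewicz, M. Ogihara, S. Toda, TCS 304 (2003) 129–156, §4 (proof of Theorem 7, `E₀`:
  "for every two edges the paths which realize the edges … are vertex disjoint").
-/

namespace Literature.Barriers.CriticalPhenomena.GridSAW

namespace SDrawing

variable {α β : Type*} [DecidableEq α] [DecidableEq β]

/-! ### The point set of a drawing -/

/-- **All grid points of a drawing**: the images of the listed vertices and the points of the
edge paths. [folklore] -/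
def points (S : SDrawing α) : List GridPoint :=
  S.verts.map S.pos ++ S.edges.flatMap fun e => e.2.2

omit [DecidableEq α] in
/-- Membership in the point set. [folklore] -/
theorem mem_points_iff (S : SDrawing α) {p : GridPoint} :
    p ∈ S.points ↔ (∃ v ∈ S.verts, S.pos v = p) ∨ ∃ e ∈ S.edges, p ∈ e.2.2 := by
  simp [points]

omit [DecidableEq α] in
/-- Vertex images are points. [folklore] -/
theorem pos_mem_points (S : SDrawing α) {v : α} (hv : v ∈ S.verts) : S.pos v ∈ S.points :=
  S.mem_points_iff.2 (Or.inl ⟨v, hv, rfl⟩)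

omit [DecidableEq α] in
/-- Path points are points. [folklore] -/
theorem path_mem_points (S : SDrawing α) {e : SEdge α} (he : e ∈ S.edges) {p : GridPoint} (hp : p ∈ e.2.2) :
    p ∈ S.points :=
  S.mem_points_iff.2 (Or.inr ⟨e, he, hp⟩)

/-! ### Relabelling -/

/-- **Relabelling the vertices** along `f`, with a left inverse `g` used to read positions.
[folklore] -/
def relabel (S : SDrawing α) (f : α → β) (g : β → α) : SDrawing β where
  verts := S.verts.map f
  pos := fun b => S.pos (g b)
  edges := S.edges.map fun e => (f e.1, f e.2.1, e.2.2)

omit [DecidableEq α] [DecidableEq β] in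
/-- The edges of a relabelled drawing. [folklore] -/
theorem mem_relabel_edges {S : SDrawing α} {f : α → β} {g : β → α} {e : SEdge β} :
    e ∈ (S.relabel f g).edges ↔ ∃ e₀ ∈ S.edges, (f e₀.1, f e₀.2.1, e₀.2.2) = e := by
  simp [relabel]

/-- The degree after relabelling along a map injective on the vertices. [folklore] -/
theorem degree_relabel {S : SDrawing α} (hS : S.IsValid) {f : α → β} {g : β → α} (hgf : ∀ a ∈ S.verts, g (f a) = a)
    {a : α} (ha : a ∈ S.verts) : (S.relabel f g).degree (f a) = S.degree a := by
  rw [degree, relabel, List.countP_map, degree]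
  refine List.countP_congr fun e he => ?_
  have h1 := hS.fst_mem e he
  have h2 := hS.snd_mem e he
  have hinj : ∀ {x}, x ∈ S.verts → (f x = f a ↔ x = a) := fun {x} hx =>
    ⟨fun h => by rw [← hgf x hx, h, hgf a ha], fun h => by rw [h]⟩
  simp only [Function.comp_apply, decide_eq_true_eq]
  rw [hinj h1, hinj h2]

/-- **Validity is preserved by relabelling** along a map with a left inverse on the vertices.
[cite: LiskiewiczOgiharaToda2003, §4 (proof of Theorem 7)] -/
theorem IsValid.relabel {S : SDrawing α} (hS : S.IsValid) (f : α → β) (g : β → α) (hgf : ∀ a ∈ S.verts, g (f a) = a) :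
    (S.relabel f g).IsValid := by
  have hinj : ∀ a ∈ S.verts, ∀ b ∈ S.verts, f a = f b → a = b := fun a ha b hb h => by
    rw [← hgf a ha, h, hgf b hb]
  have hpos : ∀ a ∈ S.verts, (S.relabel f g).pos (f a) = S.pos a := fun a ha => by
    show S.pos (g (f a)) = S.pos a; rw [hgf a ha]
  have hverts : ∀ {b}, b ∈ (S.relabel f g).verts ↔ ∃ a ∈ S.verts, f a = b := fun {b} => by simp [SDrawing.relabel]
  refine ⟨hS.nodup_verts.map_on hinj, ?_, ?_, ?_, ?_, ?_, ?_, ?_, ?_, ?_, ?_, ?_, ?_⟩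
  · intro b hb b' hb' h
    obtain ⟨a, ha, rfl⟩ := hverts.1 hb
    obtain ⟨a', ha', rfl⟩ := hverts.1 hb'
    rw [hpos a ha, hpos a' ha'] at h
    rw [hS.pos_inj a ha a' ha' h]
  · intro e he
    obtain ⟨e₀, he₀, rfl⟩ := mem_relabel_edges.1 he
    exact hverts.2 ⟨e₀.1, hS.fst_mem e₀ he₀, rfl⟩
  · intro e he
    obtain ⟨e₀, he₀, rfl⟩ := mem_relabel_edges.1 he
    exact hverts.2 ⟨e₀.2.1, hS.snd_mem e₀ he₀, rfl⟩
  · intro e he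
    obtain ⟨e₀, he₀, rfl⟩ := mem_relabel_edges.1 he
    exact fun h => hS.fst_ne_snd e₀ he₀ (hinj _ (hS.fst_mem e₀ he₀) _ (hS.snd_mem e₀ he₀) h)
  · intro e he
    obtain ⟨e₀, he₀, rfl⟩ := mem_relabel_edges.1 he
    show e₀.2.2.head? = some ((S.relabel f g).pos (f e₀.1))
    rw [hpos _ (hS.fst_mem e₀ he₀), hS.head?_eq e₀ he₀]
  · intro e he
    obtain ⟨e₀, he₀, rfl⟩ := mem_relabel_edges.1 he
    show e₀.2.2.getLast? = some ((S.relabel f g).pos (f e₀.2.1))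
    rw [hpos _ (hS.snd_mem e₀ he₀), hS.getLast?_eq e₀ he₀]
  · intro e he
    obtain ⟨e₀, he₀, rfl⟩ := mem_relabel_edges.1 he
    exact hS.nodup_path e₀ he₀
  · intro e he
    obtain ⟨e₀, he₀, rfl⟩ := mem_relabel_edges.1 he
    exact hS.isChain_path e₀ he₀
  · intro e he b hb hp
    obtain ⟨e₀, he₀, rfl⟩ := mem_relabel_edges.1 he
    obtain ⟨a, ha, rfl⟩ := hverts.1 hb
    rw [hpos a ha] at hp
    rcases hS.interior e₀ he₀ a ha hp with rfl | rfl
    · exact Or.inl rfl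
    · exact Or.inr rfl
  · rw [SDrawing.relabel, List.pairwise_map]
    refine hS.simple.imp_of_mem fun {e e'} he he' hne hsame => hne ?_
    unfold SameEndsS at hsame ⊢
    simp only at hsame
    have h1 := hS.fst_mem e he; have h2 := hS.snd_mem e he
    have h1' := hS.fst_mem e' he'; have h2' := hS.snd_mem e' he'
    rcases hsame with ⟨ha, hb⟩ | ⟨ha, hb⟩
    · exact Or.inl ⟨hinj _ h1 _ h1' ha, hinj _ h2 _ h2' hb⟩
    · exact Or.inr ⟨hinj _ h1 _ h2' ha, hinj _ h2 _ h1' hb⟩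
  · rw [SDrawing.relabel, List.pairwise_map]
    refine hS.disjoint.imp fun {e e'} h p hp hp' => ?_
    obtain ⟨v, hv, rfl⟩ := h p hp hp'
    exact ⟨f v, hverts.2 ⟨v, hv, rfl⟩, hpos v hv⟩
  · intro b hb
    obtain ⟨a, ha, rfl⟩ := hverts.1 hb
    rw [degree_relabel hS hgf ha]
    exact hS.degree_le a ha

/-! ### Translation -/

/-- Translation of a grid point. [folklore] -/
def shift (v p : GridPoint) : GridPoint := (p.1 + v.1, p.2 + v.2)

/-- Translation is injective. [folklore] -/
theorem shift_injective (v : GridPoint) : Function.Injective (shift v) := by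
  rintro ⟨a, b⟩ ⟨c, d⟩ h
  simp only [shift, Prod.mk.injEq] at h
  exact Prod.ext (by omega) (by omega)

/-- Translation preserves grid edges. [folklore] -/
theorem isGridEdge_shift {v p q : GridPoint} (h : IsGridEdge p q) : IsGridEdge (shift v p) (shift v q) := by
  unfold IsGridEdge at h ⊢
  simp only [shift]
  omega

/-- **Translating a drawing** by the vector `v`. [folklore] -/
def translate (S : SDrawing α) (v : GridPoint) : SDrawing α where
  verts := S.verts
  pos := fun a => shift v (S.pos a)
  edges := S.edges.map fun e => (e.1, e.2.1, e.2.2.map (shift v))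

omit [DecidableEq α] in
/-- The edges of a translated drawing. [folklore] -/
theorem mem_translate_edges {S : SDrawing α} {v : GridPoint} {e : SEdge α} :
    e ∈ (S.translate v).edges ↔ ∃ e₀ ∈ S.edges, (e₀.1, e₀.2.1, e₀.2.2.map (shift v)) = e := by
  simp [translate]

/-- The degrees of a translated drawing. [folklore] -/
theorem degree_translate (S : SDrawing α) (v : GridPoint) (a : α) : (S.translate v).degree a = S.degree a := by
  rw [degree, translate, List.countP_map, degree]
  exact List.countP_congr fun e _ => by simp

/-- **Validity is preserved by translation.** [cite: LiskiewiczOgiharaToda2003, §4 (proof of Theorem 7)] -/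
theorem IsValid.translate {S : SDrawing α} (hS : S.IsValid) (v : GridPoint) : (S.translate v).IsValid := by
  refine ⟨hS.nodup_verts, fun a ha b hb h => hS.pos_inj a ha b hb (shift_injective v h), ?_, ?_, ?_, ?_, ?_, ?_, ?_,
    ?_, ?_, ?_, fun a ha => by rw [degree_translate]; exact hS.degree_le a ha⟩
  · intro e he; obtain ⟨e₀, he₀, rfl⟩ := mem_translate_edges.1 he; exact hS.fst_mem e₀ he₀
  · intro e he; obtain ⟨e₀, he₀, rfl⟩ := mem_translate_edges.1 he; exact hS.snd_mem e₀ he₀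
  · intro e he; obtain ⟨e₀, he₀, rfl⟩ := mem_translate_edges.1 he; exact hS.fst_ne_snd e₀ he₀
  · intro e he; obtain ⟨e₀, he₀, rfl⟩ := mem_translate_edges.1 he
    show (e₀.2.2.map (shift v)).head? = some (shift v (S.pos e₀.1))
    rw [List.head?_map, hS.head?_eq e₀ he₀]; rfl
  · intro e he; obtain ⟨e₀, he₀, rfl⟩ := mem_translate_edges.1 he
    show (e₀.2.2.map (shift v)).getLast? = some (shift v (S.pos e₀.2.1))
    rw [List.getLast?_map, hS.getLast?_eq e₀ he₀]; rfl
  · intro e he; obtain ⟨e₀, he₀, rfl⟩ := mem_translate_edges.1 he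
    exact (hS.nodup_path e₀ he₀).map (shift_injective v)
  · intro e he; obtain ⟨e₀, he₀, rfl⟩ := mem_translate_edges.1 he
    exact List.isChain_map _ |>.2 ((hS.isChain_path e₀ he₀).imp fun _ _ h => isGridEdge_shift h)
  · intro e he a ha hp; obtain ⟨e₀, he₀, rfl⟩ := mem_translate_edges.1 he
    change shift v (S.pos a) ∈ e₀.2.2.map (shift v) at hp
    rw [List.mem_map_of_injective (shift_injective v)] at hp
    exact hS.interior e₀ he₀ a ha hp
  · rw [SDrawing.translate, List.pairwise_map]
    exact hS.simple.imp fun {e e'} h => h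
  · rw [SDrawing.translate, List.pairwise_map]
    refine hS.disjoint.imp fun {e e'} h p hp hp' => ?_
    simp only [List.mem_map] at hp hp'
    obtain ⟨q, hq, rfl⟩ := hp
    obtain ⟨q', hq', hqq⟩ := hp'
    rw [shift_injective v hqq] at hq'
    obtain ⟨w, hw, rfl⟩ := h q hq hq'
    exact ⟨w, hw, rfl⟩

/-! ### Juxtaposition -/

/-- **Juxtaposing two drawings**: concatenated vertex lists (positions read from the first drawing
on its vertices, from the second elsewhere) and concatenated edge lists. [folklore] -/
def append (S₁ S₂ : SDrawing α) : SDrawing α where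
  verts := S₁.verts ++ S₂.verts
  pos := fun a => if a ∈ S₁.verts then S₁.pos a else S₂.pos a
  edges := S₁.edges ++ S₂.edges

/-- Positions of the first part. [folklore] -/
theorem append_pos_left {S₁ S₂ : SDrawing α} {a : α} (ha : a ∈ S₁.verts) : (S₁.append S₂).pos a = S₁.pos a :=
  if_pos ha

/-- Positions of the second part (for names not in the first). [folklore] -/
theorem append_pos_right {S₁ S₂ : SDrawing α} {a : α} (ha : a ∉ S₁.verts) : (S₁.append S₂).pos a = S₂.pos a :=
  if_neg ha

/-- The degree in a juxtaposition is the sum of the degrees. [folklore] -/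
theorem degree_append (S₁ S₂ : SDrawing α) (a : α) : (S₁.append S₂).degree a = S₁.degree a + S₂.degree a := by
  simp [degree, append, List.countP_append]

omit [DecidableEq α] in
/-- A vertex on no edge has degree `0`. [folklore] -/
theorem degree_eq_zero {S : SDrawing α} [DecidableEq α] {a : α} (h : ∀ e ∈ S.edges, e.1 ≠ a ∧ e.2.1 ≠ a) : S.degree a = 0 := by
  rw [degree, List.countP_eq_zero]
  intro e he
  simp [(h e he).1, (h e he).2]

/-- **Validity of a juxtaposition**: two valid drawings on disjoint names with disjoint point
sets juxtapose to a valid drawing. [cite: LiskiewiczOgiharaToda2003, §4 (proof of Theorem 7, "vertex disjoint")] -/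
theorem IsValid.append {S₁ S₂ : SDrawing α} (h₁ : S₁.IsValid) (h₂ : S₂.IsValid)
    (hV : ∀ a ∈ S₁.verts, a ∉ S₂.verts) (hP : ∀ p ∈ S₁.points, p ∉ S₂.points) : (S₁.append S₂).IsValid := by
  have hV' : ∀ a ∈ S₂.verts, a ∉ S₁.verts := fun a ha ha' => hV a ha' ha
  have hposL : ∀ a ∈ S₁.verts, (S₁.append S₂).pos a = S₁.pos a := fun a ha => append_pos_left ha
  have hposR : ∀ a ∈ S₂.verts, (S₁.append S₂).pos a = S₂.pos a := fun a ha => append_pos_right (hV' a ha)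
  have hverts : ∀ {a}, a ∈ (S₁.append S₂).verts ↔ a ∈ S₁.verts ∨ a ∈ S₂.verts := fun {a} => List.mem_append
  have hedges : ∀ {e}, e ∈ (S₁.append S₂).edges ↔ e ∈ S₁.edges ∨ e ∈ S₂.edges := fun {e} => List.mem_append
  -- ends of the edges of each part stay in that part
  have endsL : ∀ e ∈ S₁.edges, e.1 ∈ S₁.verts ∧ e.2.1 ∈ S₁.verts := fun e he => ⟨h₁.fst_mem e he, h₁.snd_mem e he⟩
  have endsR : ∀ e ∈ S₂.edges, e.1 ∈ S₂.verts ∧ e.2.1 ∈ S₂.verts := fun e he => ⟨h₂.fst_mem e he, h₂.snd_mem e he⟩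
  refine ⟨?_, ?_, ?_, ?_, ?_, ?_, ?_, ?_, ?_, ?_, ?_, ?_, ?_⟩
  · exact List.nodup_append.2 ⟨h₁.nodup_verts, h₂.nodup_verts, fun a ha b hb hab => hV a ha (hab ▸ hb)⟩
  · intro a ha b hb hab
    rcases hverts.1 ha with ha | ha <;> rcases hverts.1 hb with hb | hb
    · rw [hposL a ha, hposL b hb] at hab; exact h₁.pos_inj a ha b hb hab
    · rw [hposL a ha, hposR b hb] at hab
      exact absurd (hab ▸ S₁.pos_mem_points ha) (fun h => hP _ h (S₂.pos_mem_points hb))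
    · rw [hposR a ha, hposL b hb] at hab
      exact absurd (hab.symm ▸ S₁.pos_mem_points hb) (fun h => hP _ h (S₂.pos_mem_points ha))
    · rw [hposR a ha, hposR b hb] at hab; exact h₂.pos_inj a ha b hb hab
  · intro e he
    rcases hedges.1 he with he | he
    · exact hverts.2 (Or.inl (endsL e he).1)
    · exact hverts.2 (Or.inr (endsR e he).1)
  · intro e he
    rcases hedges.1 he with he | he
    · exact hverts.2 (Or.inl (endsL e he).2)
    · exact hverts.2 (Or.inr (endsR e he).2)
  · intro e he
    rcases hedges.1 he with he | he
    · exact h₁.fst_ne_snd e he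
    · exact h₂.fst_ne_snd e he
  · intro e he
    rcases hedges.1 he with he | he
    · rw [hposL _ (endsL e he).1]; exact h₁.head?_eq e he
    · rw [hposR _ (endsR e he).1]; exact h₂.head?_eq e he
  · intro e he
    rcases hedges.1 he with he | he
    · rw [hposL _ (endsL e he).2]; exact h₁.getLast?_eq e he
    · rw [hposR _ (endsR e he).2]; exact h₂.getLast?_eq e he
  · intro e he
    rcases hedges.1 he with he | he
    · exact h₁.nodup_path e he
    · exact h₂.nodup_path e he
  · intro e he
    rcases hedges.1 he with he | he
    · exact h₁.isChain_path e he
    · exact h₂.isChain_path e he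
  · intro e he v hv hp
    rcases hedges.1 he with he | he <;> rcases hverts.1 hv with hv | hv
    · rw [hposL v hv] at hp; exact h₁.interior e he v hv hp
    · rw [hposR v hv] at hp
      exact absurd (S₁.path_mem_points he hp) (fun h => hP _ h (S₂.pos_mem_points hv))
    · rw [hposL v hv] at hp
      exact absurd (S₁.pos_mem_points hv) (fun h => hP _ h (S₂.path_mem_points he hp))
    · rw [hposR v hv] at hp; exact h₂.interior e he v hv hp
  · rw [SDrawing.append, List.pairwise_append]
    refine ⟨h₁.simple, h₂.simple, fun e he e' he' hsame => ?_⟩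
    have h1 := (endsL e he).1
    rcases hsame with ⟨ha, -⟩ | ⟨ha, -⟩
    · exact hV _ h1 (ha ▸ (endsR e' he').1)
    · exact hV _ h1 (ha ▸ (endsR e' he').2)
  · rw [SDrawing.append, List.pairwise_append]
    refine ⟨?_, ?_, fun e he e' he' p hp hp' => ?_⟩
    · refine h₁.disjoint.imp_of_mem fun {e e'} he he' h p hp hp' => ?_
      obtain ⟨v, hv, rfl⟩ := h p hp hp'
      exact ⟨v, hverts.2 (Or.inl hv), hposL v hv⟩
    · refine h₂.disjoint.imp_of_mem fun {e e'} he he' h p hp hp' => ?_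
      obtain ⟨v, hv, rfl⟩ := h p hp hp'
      exact ⟨v, hverts.2 (Or.inr hv), hposR v hv⟩
    · exact absurd (S₁.path_mem_points he hp) (fun h => hP _ h (S₂.path_mem_points he' hp'))
  · intro v hv
    rw [degree_append]
    rcases hverts.1 hv with hv | hv
    · rw [degree_eq_zero (S := S₂) fun e he => ⟨fun h => hV' _ (endsR e he).1 (h ▸ hv), fun h => hV' _ (endsR e he).2 (h ▸ hv)⟩]
      simpa using h₁.degree_le v hv
    · rw [degree_eq_zero (S := S₁) fun e he => ⟨fun h => hV _ (endsL e he).1 (h ▸ hv), fun h => hV _ (endsL e he).2 (h ▸ hv)⟩]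
      simpa using h₂.degree_le v hv

/-! ### Adding edges between listed vertices -/

/-- **Adding edges** to a drawing (between vertices already listed). [folklore] -/
def addEdges (S : SDrawing α) (E : List (SEdge α)) : SDrawing α where
  verts := S.verts
  pos := S.pos
  edges := S.edges ++ E

/-- The degree after adding edges. [folklore] -/
theorem degree_addEdges (S : SDrawing α) (E : List (SEdge α)) (a : α) :
    (S.addEdges E).degree a = S.degree a + E.countP fun e => decide (e.1 = a ∨ e.2.1 = a) := by
  simp [degree, addEdges, List.countP_append]

/-- **The new edges are admissible**: each joins two distinct listed vertices by a self-avoiding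
grid path between their images whose other points are no vertex image and no point of an OLD edge;
a point common to two new edges is a vertex image; no new edge repeats the end pair of an old or of
another new edge; and the degrees stay at most three.
[cite: LiskiewiczOgiharaToda2003, §4 (proof of Theorem 7, "no vertex congestion")] -/
structure NewEdgesOK (S : SDrawing α) (E : List (SEdge α)) : Prop where
  /-- ends are listed vertices -/
  fst_mem : ∀ e ∈ E, e.1 ∈ S.verts
  /-- ends are listed vertices -/
  snd_mem : ∀ e ∈ E, e.2.1 ∈ S.verts
  /-- no loops -/
  fst_ne_snd : ∀ e ∈ E, e.1 ≠ e.2.1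
  /-- the path starts at the first end -/
  head?_eq : ∀ e ∈ E, e.2.2.head? = some (S.pos e.1)
  /-- the path ends at the second end -/
  getLast?_eq : ∀ e ∈ E, e.2.2.getLast? = some (S.pos e.2.1)
  /-- the path is self-avoiding -/
  nodup_path : ∀ e ∈ E, e.2.2.Nodup
  /-- the path is a grid path -/
  isChain_path : ∀ e ∈ E, List.IsChain IsGridEdge e.2.2
  /-- the path meets vertex positions only at its ends -/
  interior : ∀ e ∈ E, ∀ v ∈ S.verts, S.pos v ∈ e.2.2 → v = e.1 ∨ v = e.2.1
  /-- a common point with an old edge is a vertex position -/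
  disjoint_old : ∀ e ∈ E, ∀ e' ∈ S.edges, ∀ p ∈ e.2.2, p ∈ e'.2.2 → ∃ v ∈ S.verts, S.pos v = p
  /-- a common point of two new edges is a vertex position -/
  disjoint_new : E.Pairwise fun e e' => ∀ p ∈ e.2.2, p ∈ e'.2.2 → ∃ v ∈ S.verts, S.pos v = p
  /-- no new edge repeats an old end pair -/
  simple_old : ∀ e ∈ E, ∀ e' ∈ S.edges, ¬ SameEndsS e e'
  /-- no two new edges with the same end pair -/
  simple_new : E.Pairwise fun e e' => ¬ SameEndsS e e'
  /-- degrees stay at most three -/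
  degree_le : ∀ v ∈ S.verts, S.degree v + E.countP (fun e => decide (e.1 = v ∨ e.2.1 = v)) ≤ 3

omit [DecidableEq α] in
/-- `SameEndsS` is symmetric. [folklore] -/
theorem sameEndsS_comm {e e' : SEdge α} : SameEndsS e e' ↔ SameEndsS e' e := by
  unfold SameEndsS
  constructor
  · rintro (⟨h1, h2⟩ | ⟨h1, h2⟩)
    · exact Or.inl ⟨h1.symm, h2.symm⟩
    · exact Or.inr ⟨h2.symm, h1.symm⟩
  · rintro (⟨h1, h2⟩ | ⟨h1, h2⟩)
    · exact Or.inl ⟨h1.symm, h2.symm⟩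
    · exact Or.inr ⟨h2.symm, h1.symm⟩

/-- **Validity is preserved by adding admissible edges.** [cite: LiskiewiczOgiharaToda2003, §4 (proof of Theorem 7)] -/
theorem IsValid.addEdges {S : SDrawing α} (hS : S.IsValid) {E : List (SEdge α)} (hE : NewEdgesOK S E) :
    (S.addEdges E).IsValid := by
  have hedges : ∀ {e}, e ∈ (S.addEdges E).edges ↔ e ∈ S.edges ∨ e ∈ E := fun {e} => List.mem_append
  refine ⟨hS.nodup_verts, hS.pos_inj, ?_, ?_, ?_, ?_, ?_, ?_, ?_, ?_, ?_, ?_, ?_⟩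
  · intro e he; rcases hedges.1 he with he | he; exacts [hS.fst_mem e he, hE.fst_mem e he]
  · intro e he; rcases hedges.1 he with he | he; exacts [hS.snd_mem e he, hE.snd_mem e he]
  · intro e he; rcases hedges.1 he with he | he; exacts [hS.fst_ne_snd e he, hE.fst_ne_snd e he]
  · intro e he; rcases hedges.1 he with he | he; exacts [hS.head?_eq e he, hE.head?_eq e he]
  · intro e he; rcases hedges.1 he with he | he; exacts [hS.getLast?_eq e he, hE.getLast?_eq e he]
  · intro e he; rcases hedges.1 he with he | he; exacts [hS.nodup_path e he, hE.nodup_path e he]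
  · intro e he; rcases hedges.1 he with he | he; exacts [hS.isChain_path e he, hE.isChain_path e he]
  · intro e he; rcases hedges.1 he with he | he; exacts [hS.interior e he, hE.interior e he]
  · rw [SDrawing.addEdges, List.pairwise_append]
    exact ⟨hS.simple, hE.simple_new, fun e he e' he' h => hE.simple_old e' he' e he (sameEndsS_comm.1 h)⟩
  · rw [SDrawing.addEdges, List.pairwise_append]
    exact ⟨hS.disjoint, hE.disjoint_new, fun e he e' he' p hp hp' => hE.disjoint_old e' he' e he p hp' hp⟩
  · intro v hv
    show (S.addEdges E).degree v ≤ 3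
    rw [degree_addEdges]
    exact hE.degree_le v hv

/-! ### A Boolean validity checker for explicit stamps -/

/-- Decidability of `SameEndsS`. [folklore] -/
instance instDecidableSameEndsS (e e' : SEdge α) : Decidable (SameEndsS e e') := by
  unfold SameEndsS; infer_instance

/-- **Boolean validity check** of a drawing (meaningful for drawings given by explicit lists:
quantifiers over `verts` and `edges` only). [folklore] -/
def validB (S : SDrawing α) : Bool :=
  decide (S.verts.Nodup) &&
  (S.verts.all fun a => S.verts.all fun b => decide (S.pos a = S.pos b → a = b)) &&
  (S.edges.all fun e => decide (e.1 ∈ S.verts) && decide (e.2.1 ∈ S.verts) && decide (e.1 ≠ e.2.1) &&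
    decide (e.2.2.head? = some (S.pos e.1)) && decide (e.2.2.getLast? = some (S.pos e.2.1)) &&
    decide (e.2.2.Nodup) && decide (List.IsChain IsGridEdge e.2.2) &&
    (S.verts.all fun v => decide (S.pos v ∈ e.2.2 → v = e.1 ∨ v = e.2.1))) &&
  decide (S.edges.Pairwise fun e e' => ¬ SameEndsS e e') &&
  decide (S.edges.Pairwise fun e e' => ∀ p ∈ e.2.2, p ∈ e'.2.2 → ∃ v ∈ S.verts, S.pos v = p) &&
  (S.verts.all fun v => decide (S.degree v ≤ 3))

/-- **The Boolean check is validity.** [folklore] -/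
theorem validB_eq_true_iff (S : SDrawing α) : S.validB = true ↔ S.IsValid := by
  constructor
  · intro h
    simp only [validB, Bool.and_eq_true, List.all_eq_true, decide_eq_true_eq] at h
    obtain ⟨⟨⟨⟨⟨hnd, hinj⟩, hedges⟩, hsimple⟩, hdis⟩, hdeg⟩ := h
    refine ⟨hnd, fun a ha b hb => hinj a ha b hb, fun e he => (hedges e he).1.1.1.1.1.1.1,
      fun e he => (hedges e he).1.1.1.1.1.1.2, fun e he => (hedges e he).1.1.1.1.1.2,
      fun e he => (hedges e he).1.1.1.1.2, fun e he => (hedges e he).1.1.1.2, fun e he => (hedges e he).1.1.2,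
      fun e he => (hedges e he).1.2, fun e he v hv => (hedges e he).2 v hv, hsimple, hdis, hdeg⟩
  · intro h
    simp only [validB, Bool.and_eq_true, List.all_eq_true, decide_eq_true_eq]
    exact ⟨⟨⟨⟨⟨h.nodup_verts, h.pos_inj⟩, fun e he => ⟨⟨⟨⟨⟨⟨⟨h.fst_mem e he, h.snd_mem e he⟩, h.fst_ne_snd e he⟩,
      h.head?_eq e he⟩, h.getLast?_eq e he⟩, h.nodup_path e he⟩, h.isChain_path e he⟩, h.interior e he⟩⟩,
      h.simple⟩, h.disjoint⟩, h.degree_le⟩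

/-- Validity from the Boolean check (the form used with `decide` on explicit stamps). [folklore] -/
theorem isValid_of_validB {S : SDrawing α} (h : S.validB = true) : S.IsValid :=
  (validB_eq_true_iff S).1 h

/-- Sanity check: the one-edge drawing passes the Boolean check (by `decide`). [folklore] -/
theorem validB_oneEdgeSDrawing : oneEdgeSDrawing.validB = true := by
  decide

/-- Sanity check: hence it is valid, and so are its translates. [folklore] -/
theorem isValid_oneEdgeSDrawing_translate (v : GridPoint) : (oneEdgeSDrawing.translate v).IsValid :=
  (isValid_of_validB validB_oneEdgeSDrawing).translate v

end SDrawing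

end Literature.Barriers.CriticalPhenomena.GridSAW
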